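import Summits.QuantumFields.BalabanUV.Beta.SymMixedJetWardSingle
import Summits.QuantumFields.BalabanUV.Beta.SymWardSiteToBlock
import Summits.QuantumFields.BalabanUV.Beta.MixedWardSiteLaw

/-!
# `BalabanUV.Beta.SymMixedWardSiteLaw` — THE SITE-LEVEL MIXED WARD LAW (W2-M)_sym OF THE (0.4)-SYMMETRISED MIXED TABLE IS A THEOREM; ITS BOND-LEVEL
# BLOCK SUM (WM-bond)_sym AT THE Λ-LOCK `cΛ = 2∕Lc⁴`, ROOT `ctr 4 Lc` (β sub-cell, row D1, TABLES-SYM-LEAN S2c∕S2d, TABLE∕KERNEL-LEVEL twin of the row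
# owner's G4-M part 2 `MixedWardSiteLaw`; an1 gen 43; the mixed WARD path toward the sym root's (T2-M₂) letter)

HONEST FRAMING (cell charter, verbatim): «discharging BetaPertH makes Bałaban's UV stability UNCONDITIONAL — a real
constructive-QFT result; it is NOT the continuum limit and NOT the Clay problem.»  HONEST DEPENDENCY (verbatim): «continuum YM on
T⁴ ⇐ BetaPertH ∧ nine spine estimates (0/9 proved); BetaPertH ⇐ (D1) ∧ (D4) ∧ CAP+tail; G-an2-4 gates asym, D1 and NE2/3/4.»
ABSOLUTE RULE (R-g25-7 ∕ R-D1-g30-1 (A)): the (0.4)-symmetrised averaging is the exp of the MEAN OF LOGS over the pair family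
`{loop^{σ,σ′}}` with weight `((d!)²·L^d)⁻¹`; every object below is the comb module's algebra read on an1's `symPhiGAt` (S2b part 1)
instead of `PhiGAt` — STATEMENT FOR STATEMENT under the dictionary `PhiXAt ↦ symPhiXAt`, `XjetAt ↦ symXjetAt`, `MσXAt ↦ symMσXAt`,
`L^{-d}·linAvgAt ↦ (d!·L^d)⁻¹·symLinU`, `L^{-d}·hessUAt ↦ ((d!)²L^d)⁻¹·symHessUAt`, `L^{-2d}·vhUAt ↦ ((d!)²L^{2d})⁻¹·symVhUAt`
(an3-g63 [AN3-G63-S2C] (C-ii): constants PER BCH ORDER; CONVENTION `(d!)²` un-normalised inside order-2 sym functionals).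
FAMILY-INDEPENDENT chart ∕ letter ∕ `Tau`-algebra lemmas of the comb module are imported BY NAME, never re-proved.
DERIVED cell leaf: [folklore] ring algebra; the `sym*` families are [our object]s.  No statement of Bałaban's papers is typed here, no
`[cite:]` tag, no `Prop` is minted, no binder of the β-function wall (`hW`/`hR`/`D1Tel`/`D1Rep`, (D1), `BetaPertH`) is instantiated or
discharged; nothing about the VALUES of `symMixFFAt`∕`symVh₂SAt` and no (T2-B)∕(T2-M₂) letter is discharged in this file.
NOT D1, NOT BetaPertH, NOT continuum, NOT Clay.  NOT summit progress.
Provenance: β sub-cell, TABLES-SYM-LEAN S2c option (C) (S2C-SCOPE-v1 94facb80ac685517), unit b2b-balaban-beta-an1-g43 (W-supplier AN1,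
FREEZE (0): scratch for a courier; an1 files nothing), 2026-08-21; no existing file touched.

## What this module proves (sym twin of `MixedWardSiteLaw` §2–§4's `siteWardM`∕`bondWardM`; §1's letters∕entries are pure `UT` algebra, the comb module's
## BY NAME; §4's `mixedWardBinders` (K-W1's `RWof` packing) and `symmetries_JsRowD1Pin_of_borderLaws` concern the COMB literal and are NOT twinned)
* §2 **`symATab_siteWard`, `symApTab_siteWard`, `symTTab_siteWard`** — the site Ward laws of the three sym ℚ-tables (an1's `SymMixedJetWardSingle.symMjetAt_gauge_single`
  at `λ = δ_u`, letters `E₀₁ E₁₂ E₂₃`, entry `(0,3)`), constants per BCH order: `(2L^d)⁻¹·h ↦ (2(d!)²L^d)⁻¹·h_sym`, `L^{-d}·q ↦ (d!·L^d)⁻¹·q_sym`, the in-bracket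
  contact `[f=f′]·q ↦ [f=f′]·d!·q_sym`; in `symTTab_siteWard` ALL `q`-contacts cancel (needs `d! ≠ 0`, a theorem over ℚ) and the commutator doubles by the LANDED
  `symHessCountAt_swap`: `Σ_κ (t_sym(f,f′;(κ,u−e_κ)) − t_sym(f,f′;(κ,u))) = 2·((2(d!)²L^d)⁻¹ h_sym(f,f′))·([u = r] − [u = x_f])`.
* §3 **`symMixKerAt_siteWard`** — (W2-M)_sym in kernel currency, general `d`, any root `ρ`, `L ≠ 0`: `Σ_κ (…) = 2·symHessKerAt(f,f′)·([u = L•y+ρ] − [u = x_f])` — the SAME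
  outer shape as the comb law (the `(d!)²` sits inside `symHessKerAt = symHessCountAt ∕ (2(d!)²L^d)`).
* §4 **`symSiteWardM`** (`d = 4`, root `ctr 4 Lc`: the hypothesis of an1's `SymWardSiteToBlock.symBondWardM_of_symSiteWardM` token for token) and **`symBondWardM`** =
  (WM-bond)_sym at `cΛ = 2∕Lc⁴`, UNCONDITIONAL for every `Lc ≠ 0`.
-/

open Finset
open scoped BigOperators
open Literature.MathematicalPhysics.QuantumFieldTheory.Balaban1983to89
open Literature.MathematicalPhysics.QuantumFieldTheory.Balaban1983to89.Beta
open scoped Nat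
open AffineAveraging (Form1 Site box toSite)
open AveragingContoursRooted (ctr ctrOff)
open AveragingHessianKernels (Bond single single_apply)
open Summit.QuantumFields.BalabanUV.Beta.SymAveragingHessianCounts (symLinCountAt symHessCountAt symHessCountAt_swap symLinKerAt symHessKerAt symVhKerAt symHessKerAt_swap)
open AveragingMixedJetTables (UT E)
open Summit.QuantumFields.BalabanUV.Beta.SymAveragingMixedJetTables (symMjetAt symATab symApTab symTTab symMixKerAt symVh2KerAt symMixFFAt)
open ExpKernelCalculus (MKer VertexFamily comp)
open KernelWard (divV)
open BalabanStepW2 (M2Of)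
open BalabanStepJetsSucc (wVH)
open PolarizationSign (reflSign WardTransversal AxisReflectionCovariant)
open ResolventReflection (bref)
open OneStepKernelFamily (TbalOf flipK)
open Summit.QuantumFields.BalabanUV.Beta.TameKernelCalculus (trK)
open Summit.QuantumFields.BalabanUV.Beta.BorderedHessian (diagK stepScale sgnK)
open Summit.QuantumFields.BalabanUV.Beta.AveragingWardRootedStencils (legInd)
open Summit.QuantumFields.BalabanUV.Beta.SpineRooted (M1At)
open Summit.QuantumFields.BalabanUV.Beta.RowD1JointEnd (JsRowD1Pin)
open Summit.QuantumFields.BalabanUV.Beta.SymRootedMixedJetLinear (symMjetAt_sum_B symMjetAt_sub_B)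
open Summit.QuantumFields.BalabanUV.Beta.SymMixedJetWardSingle (symMjetAt_gauge_single)
open Summit.QuantumFields.BalabanUV.Beta.RootedMixedTableLaw (ent_X1_a ent_X2_a ent_X1_ap ent_X2_ap ite_entry)
open Summit.QuantumFields.BalabanUV.Beta.SymWardSiteToBlock (symBondWardM_of_symSiteWardM)
open Summit.QuantumFields.BalabanUV.Beta.MixedWardSiteLaw (dInd_smul_eq_sum comm_smul_right rootComm_eq ent_W3_a₁ ent_W3_a₂ ent_W3_a₃ ent_W3_a₄ ent_W4_a
  ent_W3_ap₁ ent_W3_ap₂ ent_W3_ap₃ ent_W3_ap₄ ent_W4_ap)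

namespace Summit.QuantumFields.BalabanUV.Beta.SymMixedWardSiteLaw

/-! ## §1 The indicator gauge datum in letters, scalar bookkeeping, the `(0,3)` entries: `UT` algebra, the comb module's BY NAME -/

/-! ## §2 The site Ward laws of the sym tables `symATab`, `symApTab`, `symTTab` -/

section Tables

variable {d L : ℕ} (hL : (L : ℚ) ≠ 0)
include hL

open Classical in
/-- [folklore] **THE SITE WARD LAW OF THE TABLE `symATab`** (an1's `SymMixedJetWardSingle.symMjetAt_gauge_single` at `λ = δ_u`, letters `E₀₁, E₁₂, E₂₃`,
entry `(0,3)`). -/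
theorem symATab_siteWard (ρ : Fin d → ℤ) (μ : Fin d) (y u : Fin d → ℤ) (f f' : Bond d) :
    ∑ κ : Fin d, (symATab ρ L μ y f (κ, u - AffineAveraging.unitVec κ) f' - symATab ρ L μ y f (κ, u) f')
      = ((2 : ℚ) * ((d ! : ℚ) ^ 2 * (L : ℚ) ^ d))⁻¹ * symHessCountAt ρ L μ y f f'
          * ((if u = (L : ℤ) • y + ρ then (1 : ℚ) else 0) - (if u = f'.2 then (1 : ℚ) else 0))
        + (if f = f' then
            symLinCountAt ρ L μ y f * (((d ! : ℚ) * (L : ℚ) ^ d)⁻¹ * 2⁻¹ * (if u = f.2 then (1 : ℚ) else 0)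
              - ((2 : ℚ) * ((d ! : ℚ) ^ 2 * (L : ℚ) ^ d))⁻¹ * (d ! : ℚ) * (if u = f'.2 then (1 : ℚ) else 0)) else 0) := by
  have hd : (d ! : ℚ) ≠ 0 := Nat.cast_ne_zero.2 (Nat.factorial_ne_zero d)
  have key := symMjetAt_gauge_single (𝕜 := ℚ) (𝔸 := UT) (fun z : Site d => if u = z then (1 : ℚ) else 0) (E 2 3) (Nat.cast_ne_zero.2 (Nat.factorial_ne_zero d)) hL two_ne_zero ρ
    f f' (E 0 1) (E 1 2) μ y
  beta_reduce at key
  rw [dInd_smul_eq_sum, symMjetAt_sum_B, rootComm_eq, comm_smul_right, comm_smul_right] at key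
  have k := congrFun (congrFun key 0) 3
  simp only [symMjetAt_sub_B, Matrix.sum_apply, Matrix.sub_apply, Matrix.add_apply, Matrix.smul_apply, ite_entry, ent_X1_a, ent_X2_a,
    ent_W3_a₁, ent_W3_a₂, ent_W3_a₃, ent_W3_a₄, ent_W4_a] at k
  have eff : (f' = f) ↔ (f = f') := eq_comm
  simp only [symATab, eff] at k ⊢
  rw [k]
  simp only [smul_eq_mul, zsmul_eq_mul, mul_zero, smul_zero, add_zero, zero_add, Int.cast_mul, Int.cast_natCast]
  by_cases hff : f = f'
  · subst hff
    simp only [if_true]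
    split_ifs <;> (try field_simp) <;> ring
  · simp only [hff, if_false]
    split_ifs <;> (try field_simp) <;> ring

open Classical in
/-- [folklore] **THE SITE WARD LAW OF THE TABLE `symApTab`** (letters `E₀₁, E₂₃, E₁₂`). -/
theorem symApTab_siteWard (ρ : Fin d → ℤ) (μ : Fin d) (y u : Fin d → ℤ) (f f' : Bond d) :
    ∑ κ : Fin d, (symApTab ρ L μ y f (κ, u - AffineAveraging.unitVec κ) f' - symApTab ρ L μ y f (κ, u) f')
      = ((2 : ℚ) * ((d ! : ℚ) ^ 2 * (L : ℚ) ^ d))⁻¹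
          * (symHessCountAt ρ L μ y f' f * (if u = f.2 then (1 : ℚ) else 0)
              + symHessCountAt ρ L μ y f f' * (if u = f'.2 then (1 : ℚ) else 0))
        + (if f = f' then
            symLinCountAt ρ L μ y f * (((2 : ℚ) * ((d ! : ℚ) ^ 2 * (L : ℚ) ^ d))⁻¹ * (d ! : ℚ) * ((if u = f.2 then (1 : ℚ) else 0) + (if u = f'.2 then (1 : ℚ) else 0))
              - ((d ! : ℚ) * (L : ℚ) ^ d)⁻¹ * (if u = f.2 then (1 : ℚ) else 0)) else 0) := by
  have hd : (d ! : ℚ) ≠ 0 := Nat.cast_ne_zero.2 (Nat.factorial_ne_zero d)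
  have key := symMjetAt_gauge_single (𝕜 := ℚ) (𝔸 := UT) (fun z : Site d => if u = z then (1 : ℚ) else 0) (E 1 2) (Nat.cast_ne_zero.2 (Nat.factorial_ne_zero d)) hL two_ne_zero ρ
    f f' (E 0 1) (E 2 3) μ y
  beta_reduce at key
  rw [dInd_smul_eq_sum, symMjetAt_sum_B, rootComm_eq, comm_smul_right, comm_smul_right] at key
  have k := congrFun (congrFun key 0) 3
  simp only [symMjetAt_sub_B, Matrix.sum_apply, Matrix.sub_apply, Matrix.add_apply, Matrix.smul_apply, ite_entry, ent_X1_ap, ent_X2_ap,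
    ent_W3_ap₁, ent_W3_ap₂, ent_W3_ap₃, ent_W3_ap₄, ent_W4_ap] at k
  have eff : (f' = f) ↔ (f = f') := eq_comm
  simp only [symApTab, eff] at k ⊢
  rw [k]
  simp only [smul_eq_mul, zsmul_eq_mul, mul_zero, mul_one, add_zero, sub_zero, Int.cast_mul, Int.cast_natCast]
  by_cases hff : f = f'
  · subst hff
    simp only [if_true]
    split_ifs <;> (try field_simp) <;> ring
  · simp only [hff, if_false]
    split_ifs <;> (try field_simp) <;> ring

open Classical in
/-- [folklore] **THE SITE WARD LAW OF THE DIAGONAL RECIPE `symTTab`**: `Σ_κ (t_sym(f,f′;(κ,u−e_κ)) − t_sym(f,f′;(κ,u))) = 2·((2(d!)²L^d)⁻¹ h_sym(f,f′))·([u = r] − [u = x_f])`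
— all `q`-contacts cancel; the commutator doubles by `symHessCountAt_swap`. -/
theorem symTTab_siteWard (ρ : Fin d → ℤ) (μ : Fin d) (y u : Fin d → ℤ) (f f' : Bond d) :
    ∑ κ : Fin d, (symTTab ρ L μ y f f' (κ, u - AffineAveraging.unitVec κ) - symTTab ρ L μ y f f' (κ, u))
      = 2 * (((2 : ℚ) * ((d ! : ℚ) ^ 2 * (L : ℚ) ^ d))⁻¹ * symHessCountAt ρ L μ y f f')
          * ((if u = (L : ℤ) • y + ρ then (1 : ℚ) else 0) - (if u = f.2 then (1 : ℚ) else 0)) := by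
  have hd : (d ! : ℚ) ≠ 0 := Nat.cast_ne_zero.2 (Nat.factorial_ne_zero d)
  have hs : ∀ κ : Fin d, symTTab ρ L μ y f f' (κ, u - AffineAveraging.unitVec κ) - symTTab ρ L μ y f f' (κ, u)
      = (symATab ρ L μ y f (κ, u - AffineAveraging.unitVec κ) f' - symATab ρ L μ y f (κ, u) f')
        + (symApTab ρ L μ y f (κ, u - AffineAveraging.unitVec κ) f' - symApTab ρ L μ y f (κ, u) f')
        - (symATab ρ L μ y f' (κ, u - AffineAveraging.unitVec κ) f - symATab ρ L μ y f' (κ, u) f) := by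
    intro κ
    simp only [symTTab]
    ring
  rw [Finset.sum_congr rfl (fun κ _ => hs κ), Finset.sum_sub_distrib, Finset.sum_add_distrib, symATab_siteWard hL, symApTab_siteWard hL,
    symATab_siteWard hL, symHessCountAt_swap ρ L μ y f f']
  push_cast
  by_cases hff : f = f'
  · subst hff
    simp only [if_true]
    split_ifs <;> (try field_simp) <;> ring
  · have hff' : ¬ f' = f := fun h => hff h.symm
    simp only [hff, hff', if_false]
    split_ifs <;> (try field_simp) <;> ring

end Tables

/-! ## §3 (W2-M)_sym in kernel currency -/

section Kernels

variable {d : ℕ}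

open Classical in
/-- [folklore] **an1's SITE-LEVEL MIXED WARD LAW (W2-M)_sym FOR THE SYM TABLE — A THEOREM** (general `d`, any root `ρ`, `L ≠ 0`):
`Σ_κ (t_sym,b(f,f′;(κ,u−e_κ)) − t_sym,b(f,f′;(κ,u))) = 2·h_sym,b(f,f′)·([u = r_b] − [u = x_f])`. -/
theorem symMixKerAt_siteWard {L : ℕ} (hL : L ≠ 0) (ρ : Fin d → ℤ) (μ : Fin d) (y u : Fin d → ℤ) (f f' : Bond d) :
    ∑ κ : Fin d, (symMixKerAt ρ L μ y (κ, u - AffineAveraging.unitVec κ) f f' - symMixKerAt ρ L μ y (κ, u) f f')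
      = 2 * symHessKerAt ρ L μ y f f' * ((if u = (L : ℤ) • y + ρ then (1 : ℝ) else 0) - (if u = f.2 then (1 : ℝ) else 0)) := by
  have hLq : (L : ℚ) ≠ 0 := Nat.cast_ne_zero.2 hL
  have h := congrArg (fun q : ℚ => (q : ℝ)) (symTTab_siteWard hLq ρ μ y u f f')
  simp only [Rat.cast_sum, Rat.cast_sub, Rat.cast_mul, Rat.cast_inv, Rat.cast_pow, Rat.cast_natCast, Rat.cast_intCast,
    Rat.cast_ofNat, apply_ite (Rat.cast : ℚ → ℝ), Rat.cast_one, Rat.cast_zero] at h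
  simp only [symMixKerAt, symHessKerAt, div_eq_mul_inv]
  rw [h]
  ring

end Kernels

/-! ## §4 `d = 4`, root `ctr 4 Lc`: the hypothesis of `SymWardSiteToBlock.symBondWardM_of_symSiteWardM` verbatim, and its discharge -/

section Row

variable {Lc : ℕ} [NeZero Lc]

open Classical in
/-- [folklore] **(W2-M)_sym AT `d = 4`, ROOT `ρ_c = ctr 4 Lc`** — the hypothesis `hS` of an1's `SymWardSiteToBlock.symBondWardM_of_symSiteWardM`, token for token, a theorem. -/
theorem symSiteWardM :
    ∀ (u : Fin 4 → ℤ) (ρ' : Fin 4) (w : Fin 4 → ℤ) (β : Fin 4) (x : Fin 4 → ℤ) (β' : Fin 4) (x' : Fin 4 → ℤ),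
      ∑ κ : Fin (3 + 1),
          (symMixKerAt (ctr 4 Lc) Lc ρ' w (κ, u - B6BondElimination.unitVec κ) (β, x) (β', x')
            - symMixKerAt (ctr 4 Lc) Lc ρ' w (κ, u) (β, x) (β', x')) =
        2 * symHessKerAt (ctr 4 Lc) Lc ρ' w (β, x) (β', x')
          * ((if u = (Lc : ℤ) • w + ctr 4 Lc then (1 : ℝ) else 0) - (if u = x then (1 : ℝ) else 0)) := by
  intro u ρ' w β x β' x'
  have hU : ∀ κ : Fin 4, (B6BondElimination.unitVec κ : Fin 4 → ℤ) = AffineAveraging.unitVec κ := fun κ => by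
    funext i
    simp only [B6BondElimination.unitVec, AffineAveraging.unitVec, Pi.single_apply]
  simp only [hU]
  exact symMixKerAt_siteWard (NeZero.ne Lc) (ctr 4 Lc) ρ' w u (β, x) (β', x')

open Classical in
/-- [folklore] **THE BOND-LEVEL SYM MIXED WARD LAW (WM-bond)_sym AT THE Λ-LOCK `cΛ = 2∕Lc⁴` — UNCONDITIONAL** (the block sum
`SymWardSiteToBlock.symBondWardM_of_symSiteWardM` of `symSiteWardM`). -/
theorem symBondWardM :
    ∀ (y : Fin (3 + 1) → ℤ) (ρ' : Fin (3 + 1)) (w : Fin (3 + 1) → ℤ) (β : Fin (3 + 1)) (x : Fin (3 + 1) → ℤ) (β' : Fin (3 + 1))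
      (x' : Fin (3 + 1) → ℤ),
      ((Lc : ℝ) ^ (3 + 1))⁻¹ * (∑ v ∈ box (3 + 1) Lc, ∑ κ : Fin (3 + 1),
          ((symMixKerAt (ctr 4 Lc) Lc ρ' w (κ, (Lc : ℤ) • y + toSite v - B6BondElimination.unitVec κ) (β, x) (β', x')
              - symMixKerAt (ctr 4 Lc) Lc ρ' w (κ, (Lc : ℤ) • y + toSite v) (β, x) (β', x'))
            + (symMixKerAt (ctr 4 Lc) Lc ρ' w (κ, (Lc : ℤ) • y + toSite v - B6BondElimination.unitVec κ) (β', x') (β, x)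
              - symMixKerAt (ctr 4 Lc) Lc ρ' w (κ, (Lc : ℤ) • y + toSite v) (β', x') (β, x)))) =
        2 * ((2 / (Lc : ℝ) ^ 4) * symHessKerAt (ctr 4 Lc) Lc ρ' w (β, x) (β', x') *
          ((1 / 2 : ℝ) * (∑ v ∈ box (3 + 1) Lc, (if x' = (Lc : ℤ) • y + toSite v then (1 : ℝ) else 0))
            - (1 / 2 : ℝ) * (∑ v ∈ box (3 + 1) Lc, (if x = (Lc : ℤ) • y + toSite v then (1 : ℝ) else 0)))) :=
  symBondWardM_of_symSiteWardM symSiteWardM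

end Row

end Summit.QuantumFields.BalabanUV.Beta.SymMixedWardSiteLaw
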